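import Summits.NavierStokesRegularity.NavierStokesRegularity.Theorems.SwirlHolderTowerFunnelSeparation
import HarnessLib

/-!
# SwirlHolderTower, part 4a — homogeneous axisymmetric stream drifts `u_{α,k}` and the
# profile criterion for separable steady passive swirls (seat nsreg-p4)

Support file for the DORMANT route `SwirlThreshold` (crux stmt-NavierStokesRegularity-2002) and
the LINEAR-method ceiling of `…Theorems.SwirlHolderTowerFunnel`.  Part 3 discharged
`FunnelSeparation`; the ceiling is still conditional on the ODE fact `FunnelExponent` (principal
eigenvalue of a singular angular problem).  Parts 4a/4b replace the transcendental funnel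
eigenfunction by an EXPLICIT algebraic family, making a polynomial-rate version of the ceiling
UNCONDITIONAL.  This file is the general, reusable layer.

For angular profiles `α, k : ℝ → ℝ` the `-1`-HOMOGENEOUS AXISYMMETRIC POLOIDAL DRIFT
`u_{α,k}(x) = α(t) x/|x|² + k(t) e₃/|x|`, `t = x₃/|x| = cos ϑ` (Stokes stream function
`Ψ = ρ K(cos ϑ)`, `K = (1-t²)k`; the funnel is `α = N(2t²-1)/2`, `k = Nt/2`), at `x ≠ 0`:

* `contDiffOn_streamDrift` (smooth off the origin), `norm_streamDrift_le`
  (`|u| ≤ (|α(t)| + |k(t)|)/|x|`), `inner_self_streamDrift` (`⟪x,u⟫ = α + t k`),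
  `streamDrift_apply_two` (`u₃ = (tα + k)/|x|`);
* `divergence_streamDrift`: **`div u_{α,k} = (α + (1-t²)k' - t k)/|x|²`** — divergence free iff
  `α = t k - (1-t²) k'` (`= -K' - t k`);
* `streamDrift_swirl_equation`: for `Θ = |x|^g G(t)` (`separableSwirl g G`) the steady swirl
  equation `u·∇Θ = ΔΘ - (2/r)∂_rΘ` holds off the axis as soon as the PROFILE IDENTITY
  `g(α + tk)G + (1-t²)k G' = g(g-1)G + (1-t²)G''` holds on `(-1,1)` (with `α = -K' - tk` this is
  `K G' - g G K' = g(g-1) G + (1-t²) G''`; the funnel ODE of `FunnelODE` is the case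
  `K = (N/2)t(1-t²)`);
* general-`G` versions of the part-3c lemmas: `continuous_separableSwirl_of_abs_le`,
  `separableSwirl_eq_zero_of_cylRadius_eq_zero'`.

WHAT THIS IS NOT: not NS regularity — kinematics of a model class of steady divergence-free
drifts (not Navier–Stokes flows) calibrating LINEAR (passive-scalar) methods; hard cores
untouched; no crux claim.
-/

namespace Summit.NavierStokesRegularity.NavierStokesRegularity.Theorems.SwirlHolderTower

open Set Filter Topology Metric
open scoped Laplacian RealInnerProductSpace
open Literature.Analysis Literature.Analysis.FluidPDE

noncomputable section

variable {α k G : ℝ → ℝ}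

/-! ### The angle `t(x) = x₃/|x|` -/

/-- `y ↦ y₂/‖y‖` in the `rpow` form of part 3a. -/
theorem div_norm_eq_tau_fun :
    (fun y : EuclideanSpace ℝ (Fin 3) => y 2 / ‖y‖) =
      fun y : EuclideanSpace ℝ (Fin 3) => y 2 * (‖y‖ ^ 2) ^ (-(1 / 2 : ℝ)) :=
  funext fun y => (tau_eq y).symm

/-- `y ↦ y₂/‖y‖` is smooth at `x ≠ 0`. -/
theorem contDiffAt_div_norm {n : WithTop ℕ∞} {x : EuclideanSpace ℝ (Fin 3)} (hx : x ≠ 0) :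
    ContDiffAt ℝ n (fun y : EuclideanSpace ℝ (Fin 3) => y 2 / ‖y‖) x := by
  rw [div_norm_eq_tau_fun]; exact contDiffAt_tau hx

/-- `D[y₂/‖y‖](x) a = a₂/‖x‖ - x₂⟪x,a⟫/‖x‖³` at `x ≠ 0`. -/
theorem fderiv_div_norm_apply {x : EuclideanSpace ℝ (Fin 3)} (hx : x ≠ 0) (a : EuclideanSpace ℝ (Fin 3)) :
    fderiv ℝ (fun y : EuclideanSpace ℝ (Fin 3) => y 2 / ‖y‖) x a = a 2 / ‖x‖ - x 2 * ⟪x, a⟫ / ‖x‖ ^ 3 := by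
  rw [div_norm_eq_tau_fun]; exact fderiv_tau_apply hx a

/-- `|x₂/‖x‖| ≤ 1`, i.e. `x₂/‖x‖ ∈ [-1, 1]`. -/
theorem div_norm_mem_Icc (x : EuclideanSpace ℝ (Fin 3)) : x 2 / ‖x‖ ∈ Icc (-1 : ℝ) 1 := by
  by_cases hx : ‖x‖ = 0
  · rw [hx, div_zero]; constructor <;> norm_num
  · have hxpos : 0 < ‖x‖ := lt_of_le_of_ne (norm_nonneg x) (Ne.symm hx)
    have habs : |x 2| ≤ ‖x‖ := by
      have h2 : x 2 ^ 2 ≤ ‖x‖ ^ 2 := by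
        rw [norm_sq_eq_cylRadius_sq_add]; nlinarith [sq_nonneg (cylRadius x)]
      exact abs_le.2 (abs_le_of_sq_le_sq' h2 hxpos.le)
    rw [mem_Icc, ← abs_le, abs_div, abs_of_pos hxpos, div_le_one hxpos]
    exact habs

/-! ### The separable swirl for a general profile `G` -/

/-- **Continuity of `|x|^γ G(x₃/|x|)`** for `γ > 0` and `G ∈ C²` bounded by `M` on `[-1,1]`
(squeeze `|Θ(y)| ≤ M‖y‖^γ` at the origin). -/
theorem continuous_separableSwirl_of_abs_le (hG : ContDiff ℝ 2 G) {γ M : ℝ} (hγ : 0 < γ)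
    (hM : ∀ t ∈ Icc (-1 : ℝ) 1, |G t| ≤ M) : Continuous (separableSwirl γ G) := by
  refine continuous_iff_continuousAt.2 fun y => ?_
  by_cases hy : y = 0
  · subst hy
    have hup : Tendsto (fun z : EuclideanSpace ℝ (Fin 3) => M * ‖z‖ ^ γ) (𝓝 0) (𝓝 0) := by
      have hc : Continuous (fun z : EuclideanSpace ℝ (Fin 3) => M * ‖z‖ ^ γ) :=
        continuous_const.mul (continuous_norm.rpow_const fun _ => Or.inr hγ.le)
      simpa [Real.zero_rpow hγ.ne'] using hc.tendsto 0
    rw [ContinuousAt, separableSwirl_zero hγ]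
    refine squeeze_zero_norm (fun z => ?_) hup
    rw [separableSwirl, Real.norm_eq_abs, abs_mul, abs_of_nonneg (Real.rpow_nonneg (norm_nonneg z) γ),
      mul_comm]
    exact mul_le_mul_of_nonneg_right (hM _ (div_norm_mem_Icc z)) (Real.rpow_nonneg (norm_nonneg z) γ)
  · rw [separableSwirl_eq_profile]
    exact (contDiffAt_rpow_mul_comp_tau hG γ hy).continuousAt

/-- **Vanishing on the axis** for a general profile with `G(±1) = 0`, `γ > 0`. -/
theorem separableSwirl_eq_zero_of_cylRadius_eq_zero' {γ : ℝ} (hγ : 0 < γ) (h1 : G 1 = 0)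
    (hm1 : G (-1) = 0) {y : EuclideanSpace ℝ (Fin 3)} (hy : cylRadius y = 0) :
    separableSwirl γ G y = 0 := by
  have hsq : ‖y‖ ^ 2 = |y 2| ^ 2 := by
    rw [norm_sq_eq_cylRadius_sq_add, hy, sq_abs]; ring
  have hn : ‖y‖ = |y 2| := by
    rw [← Real.sqrt_sq (norm_nonneg y), hsq, Real.sqrt_sq (abs_nonneg _)]
  unfold separableSwirl
  rw [hn]
  rcases lt_trichotomy (y 2) 0 with hlt | heq | hgt
  · rw [abs_of_neg hlt, div_neg, div_self hlt.ne, hm1, mul_zero]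
  · rw [heq, abs_zero, Real.zero_rpow hγ.ne', zero_mul]
  · rw [abs_of_pos hgt, div_self hgt.ne', h1, mul_zero]

/-! ### The stream drift `u_{α,k}(x) = α(t) x/|x|² + k(t) e₃/|x|` -/

/-- **Smoothness off the origin** of `u_{α,k}` for `C^n` profiles. -/
theorem contDiffOn_streamDrift {n : WithTop ℕ∞} (hα : ContDiff ℝ n α) (hk : ContDiff ℝ n k) :
    ContDiffOn ℝ n (fun y : EuclideanSpace ℝ (Fin 3) =>
      (α (y 2 / ‖y‖) * (‖y‖ ^ 2) ^ (-1 : ℝ)) • y +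
        (k (y 2 / ‖y‖) * (‖y‖ ^ 2) ^ (-(1 / 2 : ℝ))) • EuclideanSpace.single 2 1)
      {x : EuclideanSpace ℝ (Fin 3) | x ≠ 0} := by
  intro x hx
  exact ((((hα.contDiffAt.comp x (contDiffAt_div_norm hx)).mul (contDiffAt_norm_sq_rpow _ hx)).smul
    contDiffAt_id).add (((hk.contDiffAt.comp x (contDiffAt_div_norm hx)).mul
      (contDiffAt_norm_sq_rpow _ hx)).smul contDiffAt_const)).contDiffWithinAt

/-- `(‖x‖²)^{-1} = (‖x‖²)⁻¹`. -/
theorem norm_sq_rpow_neg_one (x : EuclideanSpace ℝ (Fin 3)) : (‖x‖ ^ 2) ^ (-1 : ℝ) = (‖x‖ ^ 2)⁻¹ :=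
  Real.rpow_neg_one _

/-- **`⟪x, u_{α,k}(x)⟫ = α(t) + t k(t)`** at `x ≠ 0`. -/
theorem inner_self_streamDrift (α k : ℝ → ℝ) {x : EuclideanSpace ℝ (Fin 3)} (hx : x ≠ 0) :
    ⟪x, (α (x 2 / ‖x‖) * (‖x‖ ^ 2) ^ (-1 : ℝ)) • x +
        (k (x 2 / ‖x‖) * (‖x‖ ^ 2) ^ (-(1 / 2 : ℝ))) • (EuclideanSpace.single 2 1 : EuclideanSpace ℝ (Fin 3))⟫ =
      α (x 2 / ‖x‖) + x 2 / ‖x‖ * k (x 2 / ‖x‖) := by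
  have hρ : 0 < ‖x‖ := norm_pos_iff.mpr hx
  rw [inner_add_right, inner_smul_right, inner_smul_right, real_inner_self_eq_norm_sq,
    EuclideanSpace.inner_single_right, norm_sq_rpow_neg_one, norm_sq_rpow_neg_half]
  simp only [conj_trivial, one_mul]
  field_simp

/-- **`(u_{α,k}(x))₂ = (t α(t) + k(t))/|x|`** at `x ≠ 0`. -/
theorem streamDrift_apply_two (α k : ℝ → ℝ) {x : EuclideanSpace ℝ (Fin 3)} (hx : x ≠ 0) :
    ((α (x 2 / ‖x‖) * (‖x‖ ^ 2) ^ (-1 : ℝ)) • x +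
        (k (x 2 / ‖x‖) * (‖x‖ ^ 2) ^ (-(1 / 2 : ℝ))) • (EuclideanSpace.single 2 1 : EuclideanSpace ℝ (Fin 3))) 2 =
      (x 2 / ‖x‖ * α (x 2 / ‖x‖) + k (x 2 / ‖x‖)) / ‖x‖ := by
  have hρ : 0 < ‖x‖ := norm_pos_iff.mpr hx
  simp only [PiLp.add_apply, PiLp.smul_apply, PiLp.single_apply, smul_eq_mul]
  simp only [Fin.isValue, ↓reduceIte, mul_one]
  rw [norm_sq_rpow_neg_one, norm_sq_rpow_neg_half]
  field_simp

/-- **`|u_{α,k}(x)| ≤ (|α(t)| + |k(t)|)/|x|`** at `x ≠ 0`. -/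
theorem norm_streamDrift_le (α k : ℝ → ℝ) {x : EuclideanSpace ℝ (Fin 3)} (hx : x ≠ 0) :
    ‖(α (x 2 / ‖x‖) * (‖x‖ ^ 2) ^ (-1 : ℝ)) • x +
        (k (x 2 / ‖x‖) * (‖x‖ ^ 2) ^ (-(1 / 2 : ℝ))) • (EuclideanSpace.single 2 1 : EuclideanSpace ℝ (Fin 3))‖ ≤
      (|α (x 2 / ‖x‖)| + |k (x 2 / ‖x‖)|) / ‖x‖ := by
  have hρ : 0 < ‖x‖ := norm_pos_iff.mpr hx
  rw [norm_sq_rpow_neg_one, norm_sq_rpow_neg_half]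
  refine (norm_add_le _ _).trans ?_
  rw [norm_smul, norm_smul, PiLp.norm_single, norm_one, mul_one, Real.norm_eq_abs,
    Real.norm_eq_abs, abs_mul, abs_mul, abs_inv, abs_inv, abs_of_pos hρ, abs_of_pos (pow_pos hρ 2),
    add_div]
  apply le_of_eq
  field_simp

/-- **DIVERGENCE OF THE STREAM DRIFT**: `div u_{α,k}(x) = (α(t) + (1-t²)k'(t) - t k(t))/|x|²`
at `x ≠ 0` (`div(A x) = 3A + x·∇A` with `x·∇(α(t)|x|⁻²) = -2α|x|⁻²` since `t` is
`0`-homogeneous; `div(B e₃) = ∂₃B` with `∂₃t = (1-t²)/|x|`). -/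
theorem divergence_streamDrift (hα : ContDiff ℝ 1 α) (hk : ContDiff ℝ 1 k)
    {x : EuclideanSpace ℝ (Fin 3)} (hx : x ≠ 0) :
    VectorCalculus.divergence (fun y : EuclideanSpace ℝ (Fin 3) =>
      (α (y 2 / ‖y‖) * (‖y‖ ^ 2) ^ (-1 : ℝ)) • y +
        (k (y 2 / ‖y‖) * (‖y‖ ^ 2) ^ (-(1 / 2 : ℝ))) • (EuclideanSpace.single 2 1 : EuclideanSpace ℝ (Fin 3))) x =
      (α (x 2 / ‖x‖) + (1 - (x 2 / ‖x‖) ^ 2) * deriv k (x 2 / ‖x‖) - x 2 / ‖x‖ * k (x 2 / ‖x‖)) / ‖x‖ ^ 2 := by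
  have hρ : 0 < ‖x‖ := norm_pos_iff.mpr hx
  have hσ : 0 < ‖x‖ ^ 2 := pow_pos hρ 2
  -- the two coefficient functions and their derivatives at `x`
  have ht : HasFDerivAt (fun y : EuclideanSpace ℝ (Fin 3) => y 2 / ‖y‖)
      (fderiv ℝ (fun y : EuclideanSpace ℝ (Fin 3) => y 2 / ‖y‖) x) x :=
    ((contDiffAt_div_norm (n := 1) hx).differentiableAt one_ne_zero).hasFDerivAt
  have hαd : HasDerivAt α (deriv α (x 2 / ‖x‖)) (x 2 / ‖x‖) :=
    ((hα.differentiable one_ne_zero) _).hasDerivAt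
  have hkd : HasDerivAt k (deriv k (x 2 / ‖x‖)) (x 2 / ‖x‖) :=
    ((hk.differentiable one_ne_zero) _).hasDerivAt
  have hA : HasFDerivAt (fun y : EuclideanSpace ℝ (Fin 3) => α (y 2 / ‖y‖) * (‖y‖ ^ 2) ^ (-1 : ℝ))
      (α (x 2 / ‖x‖) • ((2 * ((-1 : ℝ) * (‖x‖ ^ 2) ^ ((-1 : ℝ) - 1))) •
          (innerSL ℝ x : EuclideanSpace ℝ (Fin 3) →L[ℝ] ℝ)) +
        (‖x‖ ^ 2) ^ (-1 : ℝ) • (deriv α (x 2 / ‖x‖) •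
          fderiv ℝ (fun y : EuclideanSpace ℝ (Fin 3) => y 2 / ‖y‖) x)) x :=
    (hαd.comp_hasFDerivAt x ht).mul (hasFDerivAt_norm_sq_rpow (-1 : ℝ) hx)
  have hB : HasFDerivAt (fun y : EuclideanSpace ℝ (Fin 3) => k (y 2 / ‖y‖) * (‖y‖ ^ 2) ^ (-(1 / 2 : ℝ)))
      (k (x 2 / ‖x‖) • ((2 * (-(1 / 2 : ℝ) * (‖x‖ ^ 2) ^ (-(1 / 2 : ℝ) - 1))) •
          (innerSL ℝ x : EuclideanSpace ℝ (Fin 3) →L[ℝ] ℝ)) +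
        (‖x‖ ^ 2) ^ (-(1 / 2 : ℝ)) • (deriv k (x 2 / ‖x‖) •
          fderiv ℝ (fun y : EuclideanSpace ℝ (Fin 3) => y 2 / ‖y‖) x)) x :=
    (hkd.comp_hasFDerivAt x ht).mul (hasFDerivAt_norm_sq_rpow (-(1 / 2 : ℝ)) hx)
  have hAd := hA.differentiableAt
  have hBd := hB.differentiableAt
  have hu : DifferentiableAt ℝ (fun y : EuclideanSpace ℝ (Fin 3) =>
      (α (y 2 / ‖y‖) * (‖y‖ ^ 2) ^ (-1 : ℝ)) • y) x := hAd.smul differentiableAt_id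
  have hw : DifferentiableAt ℝ (fun y : EuclideanSpace ℝ (Fin 3) =>
      (k (y 2 / ‖y‖) * (‖y‖ ^ 2) ^ (-(1 / 2 : ℝ))) • (EuclideanSpace.single 2 1 : EuclideanSpace ℝ (Fin 3))) x :=
    hBd.smul (differentiableAt_const _)
  have hid : DifferentiableAt ℝ (fun y : EuclideanSpace ℝ (Fin 3) => y) x := differentiableAt_id
  have hadd : VectorCalculus.divergence (fun y : EuclideanSpace ℝ (Fin 3) =>
      (α (y 2 / ‖y‖) * (‖y‖ ^ 2) ^ (-1 : ℝ)) • y +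
        (k (y 2 / ‖y‖) * (‖y‖ ^ 2) ^ (-(1 / 2 : ℝ))) • (EuclideanSpace.single 2 1 : EuclideanSpace ℝ (Fin 3))) x =
      VectorCalculus.divergence (fun y : EuclideanSpace ℝ (Fin 3) =>
          (α (y 2 / ‖y‖) * (‖y‖ ^ 2) ^ (-1 : ℝ)) • y) x +
        VectorCalculus.divergence (fun y : EuclideanSpace ℝ (Fin 3) =>
          (k (y 2 / ‖y‖) * (‖y‖ ^ 2) ^ (-(1 / 2 : ℝ))) • (EuclideanSpace.single 2 1 : EuclideanSpace ℝ (Fin 3))) x := by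
    simp only [VectorCalculus.divergence]
    rw [fderiv_fun_add hu hw, ContinuousLinearMap.toLinearMap_add, map_add]
  rw [hadd, divergence_smul_pt hAd hid, divergence_smul_pt hBd (differentiableAt_const _),
    Sverak2011.divergence_id_three, divergence_fun_const, hA.fderiv, hB.fderiv]
  simp only [add_apply, FunLike.coe_smul, Pi.smul_apply, innerSL_apply_apply, smul_eq_mul,
    real_inner_self_eq_norm_sq, EuclideanSpace.inner_single_right, conj_trivial, one_mul,
    fderiv_div_norm_apply hx, PiLp.single_apply]
  simp only [Fin.isValue, ↓reduceIte]
  rw [Real.rpow_sub_one hσ.ne', Real.rpow_sub_one hσ.ne', norm_sq_rpow_neg_one, norm_sq_rpow_neg_half]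
  field_simp
  ring

/-- **The stream drift is divergence free** when `α = t k - (1-t²) k'` (i.e. `α = -K' - tk` for
the stream profile `K = (1-t²)k`). -/
theorem divergence_streamDrift_eq_zero (hα : ContDiff ℝ 1 α) (hk : ContDiff ℝ 1 k)
    (hrel : ∀ t ∈ Icc (-1 : ℝ) 1, α t = t * k t - (1 - t ^ 2) * deriv k t)
    {x : EuclideanSpace ℝ (Fin 3)} (hx : x ≠ 0) :
    VectorCalculus.divergence (fun y : EuclideanSpace ℝ (Fin 3) =>
      (α (y 2 / ‖y‖) * (‖y‖ ^ 2) ^ (-1 : ℝ)) • y +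
        (k (y 2 / ‖y‖) * (‖y‖ ^ 2) ^ (-(1 / 2 : ℝ))) • (EuclideanSpace.single 2 1 : EuclideanSpace ℝ (Fin 3))) x = 0 := by
  rw [divergence_streamDrift hα hk hx, hrel _ (div_norm_mem_Icc x)]
  ring

/-! ### The profile criterion for the steady swirl equation -/

/-- **STEADY SWIRL EQUATION FROM THE PROFILE IDENTITY.**  If `G ∈ C²`, `α, k ∈ C¹` and
`g(α + tk)G + (1-t²)k G' = g(g-1)G + (1-t²)G''` on `(-1,1)`, then `Θ = |x|^g G(x₃/|x|)` solves
`u_{α,k}·∇Θ = ΔΘ - (2/r)∂_rΘ` at every point off the axis (the residual is `|x|^{g-2}` times the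
defect of the identity at `t = x₃/|x|`). -/
theorem streamDrift_swirl_equation (hG : ContDiff ℝ 2 G) (α k : ℝ → ℝ) (g : ℝ)
    (hE : ∀ t ∈ Ioo (-1 : ℝ) 1,
      g * (α t + t * k t) * G t + (1 - t ^ 2) * k t * deriv G t =
        g * (g - 1) * G t + (1 - t ^ 2) * deriv (deriv G) t)
    {x : EuclideanSpace ℝ (Fin 3)} (hx : cylRadius x ≠ 0) :
    convect (fun y : EuclideanSpace ℝ (Fin 3) =>
        (α (y 2 / ‖y‖) * (‖y‖ ^ 2) ^ (-1 : ℝ)) • y +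
          (k (y 2 / ‖y‖) * (‖y‖ ^ 2) ^ (-(1 / 2 : ℝ))) • (EuclideanSpace.single 2 1 : EuclideanSpace ℝ (Fin 3)))
        (separableSwirl g G) x =
      (Δ (separableSwirl g G)) x - 2 / cylRadius x * partialDeriv (eR x) (separableSwirl g G) x := by
  have hEx := hE _ (div_norm_mem_Ioo hx)
  have hr : 0 < cylRadius x := lt_of_le_of_ne (cylRadius_nonneg x) (Ne.symm hx)
  have hx0 : x ≠ 0 := by
    rintro rfl
    exact hx (by simp [cylRadius])
  have hρ : 0 < ‖x‖ := norm_pos_iff.mpr hx0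
  rw [separableSwirl_eq_profile, convect_apply, partialDeriv_apply,
    fderiv_rpow_mul_comp_tau_apply hG g hx0, fderiv_rpow_mul_comp_tau_apply hG g hx0,
    laplacian_rpow_mul_comp_tau hG g hx0, inner_self_streamDrift α k hx0, streamDrift_apply_two α k hx0,
    inner_self_eR hx, eR_apply_two]
  set ρ : ℝ := ‖x‖ with hρdef
  set r : ℝ := cylRadius x with hrdef
  set Q : ℝ := ‖x‖ ^ g with hQ
  have hρ0 : ρ ≠ 0 := hρ.ne'
  field_simp
  field_simp at hEx
  linear_combination (Q * r) * hEx

end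

end Summit.NavierStokesRegularity.NavierStokesRegularity.Theorems.SwirlHolderTower
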